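import Summits.AtomisticToContinuum.Crystallization.Theorems.FrustratedLawDichotomyStrainedPatchMembership

/-!
# ROUTE (D) — THE DIRECT RECORD: no recut, binders at the law, graded basin, raw first-order LP, cleared membership; (T2ᴰ) PROVED
# (27623 strained-patch piece, T-side [CORE-FAR]; decomp-a2c lens-5, generation 55; after census KADM29-♭ (ρ1)/(ρ2), MU29 §5, BUDGET54)

(Imports lens-5 g55 `…StrainedPatchMembership` (MG), hence the tree's `…RecutLS`.)

WHY (census KADM29-♭, 2026-09-02).  The ♭ record `coreOff_record_g55b` re-cuts the comparison lattice by the least-squares linear part `A_LS` of the chart's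
deviation and needs `‖A_LS‖ ≤ κ♭₀·t = (3/20)t` of the ROOM's chart ((ROOMᴸ) = `FamilyRoomLSG`).  KAPPA-ADM (j346852): the admissible sup of `‖A_LS(u)‖/T₀` is the
UNCONSTRAINED annulus constant `0.2588 / 0.2629 / 0.2962 / 0.2545` (HM62 / HZ00 / FZ00 / HE52) — the force cap never binds the affine modes — so (R1) fails on
the ∃ side everywhere, and the LS-corrected re-charting (ρ2) moves HM62's centre level to `0.0685 > 1/16`.  Meanwhile MU29 §5 measured what the recut was FOR:
the first-order cost of NOT removing an affine mode `A` is `⟨Γ(z₀), A⟩` with `‖Γ‖_nuc·(2/5)T₀ = 18 / 13 / 24 / 54 %` of `S_hom` (order HZ00 / FZ00 / HE52 / HM62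
from here on) — at the admissible radius `≈ 0.26–0.30` only `≈ 12 / 10 / 15 / 35 %`, against level-2 budgets of `+70 / +89 / +61 / +53 %` (BUDGET54, T2⁻ currency,
honest μ).  So the recut costs more
than it saves: (RF)+(DOM)+(R1)+(R6)+(R7)+the Φ-table level shifts+the `±(9/10)t` reading surcharge all exist only to quotient three affine modes whose price,
paid directly inside the first-order LP, is smaller than the recut's own allowance.  ROUTE (D) pays it directly.

THE RECORD (§3) `coreOff_record_g55d` — [CORE-FAR] `CoreOffTubeFloor (63/10) (63/10) (24/5) (1/100) 0` from SEVEN hypotheses, FIVE binders + two floors, over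
the g52 chart family of record `𝓘₀ := bentFamily 𝓑₀ (1/16)` (`ChartFamilyD`), comparison instance = THE CHART INSTANCE ITSELF:
  (BASᴰ)  `BasinD`        := `BasinLaw 𝓘₀ (1/4) κA₁ T₀` — a chart (coarse `1/4`, RAW annulus roughness `t ≤ T₀(z₀)`) is `κA₁·T₀(z₀)`-fine on the whole ball,
                            `κA₁ = 5/2`, the radius graded by the INSTANCE's law (AT the law, never by the chart's own `t`: see `BasinLaw`)
                            [ANALYTIC · INSTRUMENTABLE: census BASIN rays on the RAW chart; KADM29 BASIN29 j346853 pending; `5/2` covers the KAPPA28 ray max `1.99`×1.25];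
  (MEMᴰ μ) `MembershipD μ` := `MembershipLaw 𝓘₀ (1/4) κA₁ T₀ μ` — fine radius `κA₁·T₀(z₀)`, column of record `clearedColumn κA₁ T₀ μ_adv` (MG: ZERO where the
                            collars clear `κA₁·T₀(z₀)` — a decidable per-instance certificate; elsewhere the census table `μ_adv`);
  (LINᴰ Ψ) `SlavedD Ψ`     := `SlavedLaw 𝓘₀ (1/4) δ₀ T₀ G₀ w₀ Ψ` — `−Ψ(z₀)(T₀ z₀) ≤ lin_{G₀}(dev) − quad_{w₀}(dev)` for the RAW deviation (affine modes INCLUDED, no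
                            `projectedFree`): `Ψ(z₀)(T₀)` = the census's JOINT LP over the KADM29 polytope (`‖u_a‖ ≤ T₀` free sites, force cap on the reach, window rows);
  (F2)    `FamilyRoomBent0` — THE TREE's g52 ROOM BINDER OF RECORD, verbatim (every later room binder on a subfamily implies it: `FamilyRoom.mono_family`);
  (F3ᴰ)   `FamilyCert 𝓘₀ 0 (withColumns Ψ μ) T₀` — DIAGONAL table certificate `0 ≤ S(z₀) − (Ψ(z₀)(T₀) + ϱ₀(z₀) + μ(z₀))` (no pairs, no level shift, no surcharge);
  [BRIDGE] `BandFarFloor … (3/50) (1/10) 0`, [SOFT-FAR] `SoftFarFloor … (1/10) 0` — as in every record since g50.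
(T2ᴰ) `TaylorTwoD := SmoothTaylorTwo 𝓘₀ (1/4) δ₀ G₀ w₀ ϱ₀` is PROVED here (`taylorTwoD_holds`) from the tree's `taylorTwoBentW_holds` by family antitonicity
(`𝓘₀ ≤ bentFamilyW 𝓑₀ (1/16) ≤ 𝓘₁ʷ`) and the new coarse-parameter monotonicity `chartBy_mono_tau` (a `1/4`-coarse chart is a `7/20`-coarse chart).
GONE: (RF), (DOM), (R1), (R6)/(R7), `RecutNear`, `LevelNear`, `projectedFree`, `InteriorChartW`, `ShellGap`, KAPPA-ADM, the Φ₁/Φ₂ shifted tables.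
KILL SIGN (census ASK JOINT-LP): route (D) dies at a host iff `Ψ_raw(z₀)(T₀) + ϱ₀(z₀) + clearedColumn(z₀) > S(z₀)` there; by MU29 §5 + KADM29 the separate worst
case leaves HM62 at `≈ +18 %` (`53 − 35`), the joint LP can only be better; HZ00 / FZ00 / HE52 `≥ +46 %` (`70 − 12`, `89 − 10`, `61 − 15`).
ALL BINDERS AT THE LAW: every level-2 statement is read at `t = T₀(z₀)` (charts of roughness `≤ T₀(z₀)` count as charts at `T₀(z₀)`), which is all the seam consumes
and exactly what the census instruments certify; a modulus graded by the chart's own roughness `t < T₀(z₀)` would assert more than anyone checks (and for the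
basin it is refutable, see `BasinLaw`).
§1 chart monotonicity in `τ`, (T2ᴰ); §2 the binders `BasinLaw` / `SlavedLaw` / `AdmBound` / `FamilyEnvelopeLaw` at the law, the two seams, the trades from the
tree's binders; §3 pins and the record; §4 the same (MEM-law) for the recut fallback (LU / Φ₂): `PairedBasinL`, `PairedMembershipL` (+ cleared trade), the paired seam.
No sorry, no new axioms, no cite tokens, no instances / notation.  `--supports stmt-AtomisticToContinuum-27623`.
-/

noncomputable section

namespace Summit.AtomisticToContinuum.Crystallization.Theorems.FrustratedLawDichotomyStrainedPatchDirect

open scoped BigOperators Classical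
open Summit.AtomisticToContinuum.Crystallization.Theorems.FrustratedLawDichotomyPeriodicBlockFlags (goodAtScale_mono)
open Summit.AtomisticToContinuum.Crystallization.Theorems.FrustratedLawDichotomyRangeCut (Sep)
open Summit.AtomisticToContinuum.Crystallization.Theorems.FrustratedLawDichotomyMotifLemmas
open Summit.AtomisticToContinuum.Crystallization.Theorems.FrustratedLawDichotomyAveragingCut
open Summit.AtomisticToContinuum.Crystallization.Theorems.FrustratedLawDichotomyAveragingRuleCap
open Summit.AtomisticToContinuum.Crystallization.Theorems.FrustratedLawDichotomyAveragingRuleTightFree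
open Summit.AtomisticToContinuum.Crystallization.Theorems.FrustratedLawDichotomyStrainedPatchHomSplit
open Summit.AtomisticToContinuum.Crystallization.Theorems.FrustratedLawDichotomyStrainedPatchCleanCollar
open Summit.AtomisticToContinuum.Crystallization.Theorems.FrustratedLawDichotomyStrainedPatchHomIsometry
open Summit.AtomisticToContinuum.Crystallization.Theorems.FrustratedLawDichotomyStrainedPatchHomTubeIso
open Summit.AtomisticToContinuum.Crystallization.Theorems.FrustratedLawDichotomyStrainedPatchPhaseCut
open Summit.AtomisticToContinuum.Crystallization.Theorems.FrustratedLawDichotomyStrainedPatchCoreTube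
open Summit.AtomisticToContinuum.Crystallization.Theorems.FrustratedLawDichotomyStrainedPatchCoreTubeRecord
open Summit.AtomisticToContinuum.Crystallization.Theorems.FrustratedLawDichotomyStrainedPatchStrainBands
open Summit.AtomisticToContinuum.Crystallization.Theorems.FrustratedLawDichotomyStrainedPatchChartFamilies
open Summit.AtomisticToContinuum.Crystallization.Theorems.FrustratedLawDichotomyStrainedPatchChartFamiliesBent
open Summit.AtomisticToContinuum.Crystallization.Theorems.FrustratedLawDichotomyStrainedPatchChartFamiliesPinned
open Summit.AtomisticToContinuum.Crystallization.Theorems.FrustratedLawDichotomyStrainedPatchEnvelopeLaw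
open Summit.AtomisticToContinuum.Crystallization.Theorems.FrustratedLawDichotomyStrainedPatchEnvelopeTaylor
open Summit.AtomisticToContinuum.Crystallization.Theorems.FrustratedLawDichotomyStrainedPatchWindowFamilies
open Summit.AtomisticToContinuum.Crystallization.Theorems.FrustratedLawDichotomyStrainedPatchRecutPairs
open Summit.AtomisticToContinuum.Crystallization.Theorems.FrustratedLawDichotomyStrainedPatchWindowTaylorTail (taylorTwoBentW_holds)
open Summit.AtomisticToContinuum.Crystallization.Theorems.FrustratedLawDichotomyStrainedPatchMembership

/-! ## §1. Charts are monotone in the coarse parameter; (T2) descends to the chart family at coarse `1/4` -/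

/-- A chart with coarse parameter `τ` is a chart with any coarse parameter `τ' ≥ τ` (the coarse clause loosens, the covered ball `63/10 − τ'` shrinks).
[formal bookkeeping] -/
theorem chartBy_mono_tau {𝓘 : (M₀ : ℕ) → (Fin M₀ → E3) → Fin M₀ → Prop} {τ τ' t : ℝ} {M : ℕ} {z : Fin M → E3} {c : Fin M} {M₀ : ℕ} {z₀ : Fin M₀ → E3}
    {c₀ : Fin M₀} {e : Fin M → Fin M₀} (h : ChartBy 𝓘 τ t z c z₀ c₀ e) (hle : τ ≤ τ') : ChartBy 𝓘 τ' t z c z₀ c₀ e :=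
  ⟨h.1, h.2.1, fun a ha => (h.2.2.1 a ha).trans hle, h.2.2.2.1, h.2.2.2.2.1, fun b₀ hb₀ => h.2.2.2.2.2 b₀ (by linarith)⟩

/-- (T2) is ANTITONE in the coarse parameter: proved at coarse `τ'`, it holds at every `τ ≤ τ'`. [formal bookkeeping] -/
theorem smoothTaylorTwo_mono_tau {𝓘 : (M₀ : ℕ) → (Fin M₀ → E3) → Fin M₀ → Prop} {τ τ' δ : ℝ} (hle : τ ≤ τ')
    {G : (M₁ : ℕ) → (Fin M₁ → E3) → Fin M₁ → Fin M₁ → (E3 →L[ℝ] ℝ)} {w : (M₁ : ℕ) → (Fin M₁ → E3) → Fin M₁ → Fin M₁ → Fin M₁ → ℝ}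
    {ϱ : (M₁ : ℕ) → (Fin M₁ → E3) → Fin M₁ → ℝ} (h : SmoothTaylorTwo 𝓘 τ' δ G w ϱ) : SmoothTaylorTwo 𝓘 τ δ G w ϱ :=
  fun M z c M₁ z₁ c₁ e t hz hch hf => h M z c M₁ z₁ c₁ e t hz (chartBy_mono_tau hch hle) hf

/-- ★ **THE CHART FAMILY OF ROUTE (D) `𝓘₀ := bentFamily 𝓑₀ (1/16)`** — the g52 chart family of record (admissible `133/10`-windows of `𝓑₀`-bent lattices with a
`1/16`-good centre); its room binder is the tree's `FamilyRoomBent0`. -/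
def ChartFamilyD : (M₀ : ℕ) → (Fin M₀ → E3) → Fin M₀ → Prop := bentFamily bends0 eta00

/-- `𝓘₀ ≤ 𝓘₁ʷ` (admissible ⟹ window-admissible; `𝓑₀ ⊆ 𝓑₁`; `1/16 ≤ 7/100`). [formal bookkeeping] -/
theorem chartFamilyD_le_compFamilyW : FamilyLE ChartFamilyD CompFamilyW :=
  (bentFamily_le_W bends0 eta00).trans (bentFamilyW_le_compFamilyW bends0_subset_bends1 (by rw [eta00, eta30]; norm_num))

/-- (LAW) on `𝓘₀`: `T₀ ≤ tmax₀ = 1/60`. [formal bookkeeping] -/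
theorem lawLE_chartFamilyD : LawLE ChartFamilyD T0 tmax0 := by
  rw [tmax0]; exact lawLE_T0_bent bends0 (by rw [eta00])

/-- ★ **(T2ᴰ)** `:= SmoothTaylorTwo 𝓘₀ (1/4) δ₀ G₀ w₀ ϱ₀` — the second-order remainder lemma on the chart family itself, coarse `1/4`. -/
def TaylorTwoD : Prop := SmoothTaylorTwo ChartFamilyD tau0 delta0 G0 w0 rho0

/-- (T2ʷ) ⟹ (T2ᴰ) (family antitonicity + coarse-parameter monotonicity `1/4 ≤ 7/20`). [formal bookkeeping] -/
theorem taylorTwoD_of_W (h : TaylorTwoBentW) : TaylorTwoD :=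
  smoothTaylorTwo_mono_tau (by rw [tau0, tau1]; norm_num) (smoothTaylorTwo_anti chartFamilyD_le_compFamilyW h)

/-- ★★ **(T2ᴰ) HOLDS** — from the tree theorem `taylorTwoBentW_holds`. [folklore] -/
theorem taylorTwoD_holds : TaylorTwoD := taylorTwoD_of_W taylorTwoBentW_holds

/-! ## §2. The binders of route (D) AT THE LAW, the two seams, the trades -/

/-- ★ **(BAS-law) `BasinLaw 𝓘 τ κA T`** [ANALYTIC — interior slaving of the sup · UNDECIDED · INSTRUMENTABLE] — an admissible clean mono-phase cluster charted
(coarse `τ`, raw annulus roughness `0 ≤ t ≤ T(z₀)`) by an instance `z₀` of `𝓘` is `κA·T(z₀)`-FINELY charted by it on the whole `63/10`-ball: the basin radius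
is graded by the INSTANCE's law value, never by the chart's own roughness (a `κA·t` output for `t < T(z₀)` is refutable: at `t = 0` rotate the reach rigidly
against the rim within the slack of the one-move stability — deviation `> 0 = κA·0`).  Census instrument: BASIN rays on the RAW chart at `t = T₀(z₀)`. -/
def BasinLaw (𝓘 : (M₀ : ℕ) → (Fin M₀ → E3) → Fin M₀ → Prop) (τ κA : ℝ) (T : (M₀ : ℕ) → (Fin M₀ → E3) → Fin M₀ → ℝ) : Prop :=
  ∀ (M : ℕ) (z : Fin M → E3) (c : Fin M) (M₀ : ℕ) (z₀ : Fin M₀ → E3) (c₀ : Fin M₀) (e : Fin M → Fin M₀) (t : ℝ),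
    Admissible M z c → CleanBall (63 / 10) z c → MonoPhaseBall (63 / 10) z c → 0 ≤ t → t ≤ T M₀ z₀ c₀ → ChartBy 𝓘 τ t z c z₀ c₀ e →
      FineChart (κA * T M₀ z₀ c₀) z c z₀ c₀ e

/-- ★ **(LIN-law) `SlavedLaw 𝓘 τ δ T G w Ψ`** [MECHANICS — the first-order LP on the RAW deviation · UNDECIDED · INSTRUMENTABLE] — for an admissible clean
mono-phase cluster charted (coarse `τ`, raw roughness `0 ≤ t ≤ T(z₀)`) and `δ`-finely charted by an instance `z₀` of `𝓘`: `−Ψ(z₀)(T z₀) ≤ lin_G(dev) − quad_w(dev)`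
— the column is READ AT THE LAW.  No affine projection: the three affine modes of `dev` are priced INSIDE `Ψ` (`⟨Γ(z₀), A⟩`, MU29 §5).  Census instrument: the
JOINT LP over the KADM29 polytope (`‖u_a‖ ≤ T₀` on the rim, one-move stability on the reach, window rows, `‖u‖ ≤ δ`). -/
def SlavedLaw (𝓘 : (M₀ : ℕ) → (Fin M₀ → E3) → Fin M₀ → Prop) (τ δ : ℝ) (T : (M₀ : ℕ) → (Fin M₀ → E3) → Fin M₀ → ℝ)
    (G : (M₁ : ℕ) → (Fin M₁ → E3) → Fin M₁ → Fin M₁ → (E3 →L[ℝ] ℝ)) (w : (M₁ : ℕ) → (Fin M₁ → E3) → Fin M₁ → Fin M₁ → Fin M₁ → ℝ)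
    (Ψ : (M₁ : ℕ) → (Fin M₁ → E3) → Fin M₁ → ℝ → ℝ) : Prop :=
  ∀ (M : ℕ) (z : Fin M → E3) (c : Fin M) (M₀ : ℕ) (z₀ : Fin M₀ → E3) (c₀ : Fin M₀) (e : Fin M → Fin M₀) (t : ℝ),
    Admissible M z c → CleanBall (63 / 10) z c → MonoPhaseBall (63 / 10) z c → 0 ≤ t → t ≤ T M₀ z₀ c₀ → ChartBy 𝓘 τ t z c z₀ c₀ e →
      FineChart δ z c z₀ c₀ e → -Ψ M₀ z₀ c₀ (T M₀ z₀ c₀) ≤ linTerm G z c z₀ c₀ e - quadTerm w z c z₀ c₀ e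

/-- ★ **(ADM-law) `AdmBound 𝓘 τ δ T ℓ β`** [MECHANICS — an LP-bounded functional of the charted cluster · UNDECIDED · INSTRUMENTABLE: the census LP over the
admissible polytope, Lean-side an LP DUAL certificate (critic row 1024 (iv))] — for an admissible clean mono-phase cluster charted (coarse `τ`, roughness
`0 ≤ t ≤ T(z₀)`) and `δ`-finely charted by an instance `z₀` of `𝓘`: `ℓ(z, c; z₀, c₀, e) ≤ β(z₀)`.  This is the critic's `AdmLinBound ℓ a` (row 1024 (vi δ)) with the
bound READ AT THE LAW (`β(z₀) = a(z₀)·T(z₀)`; a bound `a·t` graded by the chart's own roughness is refutable at `t = 0` like the basin).  (LIN-law) is the instance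
`ℓ = quad_w − lin_G`, `β = Ψ(·)(T ·)` (`slavedLaw_iff_admBound`); the signed affine term `⟨Γ(z₀), A_LS⟩`, the level-transport functional of (R7) and the budget's
full linear form are instances; the JOINT bound of a sum is an instance too and is what the census LP delivers (`admBound_add` is only the weaker separate sum). -/
def AdmBound (𝓘 : (M₀ : ℕ) → (Fin M₀ → E3) → Fin M₀ → Prop) (τ δ : ℝ) (T : (M₀ : ℕ) → (Fin M₀ → E3) → Fin M₀ → ℝ)
    (ℓ : (M : ℕ) → (Fin M → E3) → Fin M → (M₀ : ℕ) → (Fin M₀ → E3) → Fin M₀ → (Fin M → Fin M₀) → ℝ) (β : (M₀ : ℕ) → (Fin M₀ → E3) → Fin M₀ → ℝ) : Prop :=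
  ∀ (M : ℕ) (z : Fin M → E3) (c : Fin M) (M₀ : ℕ) (z₀ : Fin M₀ → E3) (c₀ : Fin M₀) (e : Fin M → Fin M₀) (t : ℝ),
    Admissible M z c → CleanBall (63 / 10) z c → MonoPhaseBall (63 / 10) z c → 0 ≤ t → t ≤ T M₀ z₀ c₀ → ChartBy 𝓘 τ t z c z₀ c₀ e →
      FineChart δ z c z₀ c₀ e → ℓ M z c M₀ z₀ c₀ e ≤ β M₀ z₀ c₀

/-- (LIN-law) IS an (ADM-law): `SlavedLaw 𝓘 τ δ T G w Ψ ↔ AdmBound 𝓘 τ δ T (quad_w − lin_G) (Ψ(·)(T ·))`. [formal bookkeeping] -/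
theorem slavedLaw_iff_admBound {𝓘 : (M₀ : ℕ) → (Fin M₀ → E3) → Fin M₀ → Prop} {τ δ : ℝ} {T : (M₀ : ℕ) → (Fin M₀ → E3) → Fin M₀ → ℝ}
    {G : (M₁ : ℕ) → (Fin M₁ → E3) → Fin M₁ → Fin M₁ → (E3 →L[ℝ] ℝ)} {w : (M₁ : ℕ) → (Fin M₁ → E3) → Fin M₁ → Fin M₁ → Fin M₁ → ℝ}
    {Ψ : (M₁ : ℕ) → (Fin M₁ → E3) → Fin M₁ → ℝ → ℝ} :
    SlavedLaw 𝓘 τ δ T G w Ψ ↔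
      AdmBound 𝓘 τ δ T (fun _ z c _ z₀ c₀ e => quadTerm w z c z₀ c₀ e - linTerm G z c z₀ c₀ e) (fun M₀ z₀ c₀ => Ψ M₀ z₀ c₀ (T M₀ z₀ c₀)) := by
  constructor
  · intro h M z c M₀ z₀ c₀ e t hz hcl hm ht htT hch hf; have := h M z c M₀ z₀ c₀ e t hz hcl hm ht htT hch hf; dsimp only; linarith
  · intro h M z c M₀ z₀ c₀ e t hz hcl hm ht htT hch hf; have := h M z c M₀ z₀ c₀ e t hz hcl hm ht htT hch hf; dsimp only at this; linarith

/-- (ADM-law) bounds ADD (the separate worst case; the census's JOINT LP for `ℓ₁ + ℓ₂` is sharper and is itself an (ADM-law)). [formal bookkeeping] -/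
theorem admBound_add {𝓘 : (M₀ : ℕ) → (Fin M₀ → E3) → Fin M₀ → Prop} {τ δ : ℝ} {T : (M₀ : ℕ) → (Fin M₀ → E3) → Fin M₀ → ℝ}
    {ℓ₁ ℓ₂ : (M : ℕ) → (Fin M → E3) → Fin M → (M₀ : ℕ) → (Fin M₀ → E3) → Fin M₀ → (Fin M → Fin M₀) → ℝ} {β₁ β₂ : (M₀ : ℕ) → (Fin M₀ → E3) → Fin M₀ → ℝ}
    (h₁ : AdmBound 𝓘 τ δ T ℓ₁ β₁) (h₂ : AdmBound 𝓘 τ δ T ℓ₂ β₂) :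
    AdmBound 𝓘 τ δ T (fun M z c M₀ z₀ c₀ e => ℓ₁ M z c M₀ z₀ c₀ e + ℓ₂ M z c M₀ z₀ c₀ e) (fun M₀ z₀ c₀ => β₁ M₀ z₀ c₀ + β₂ M₀ z₀ c₀) :=
  fun M z c M₀ z₀ c₀ e t hz hcl hm ht htT hch hf =>
    add_le_add (h₁ M z c M₀ z₀ c₀ e t hz hcl hm ht htT hch hf) (h₂ M z c M₀ z₀ c₀ e t hz hcl hm ht htT hch hf)

/-- (ADM-law) is MONOTONE in the bound table and ANTITONE in the family. [formal bookkeeping] -/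
theorem admBound_mono {𝓘 𝓘' : (M₀ : ℕ) → (Fin M₀ → E3) → Fin M₀ → Prop} (hle : FamilyLE 𝓘 𝓘') {τ δ : ℝ} {T : (M₀ : ℕ) → (Fin M₀ → E3) → Fin M₀ → ℝ}
    {ℓ : (M : ℕ) → (Fin M → E3) → Fin M → (M₀ : ℕ) → (Fin M₀ → E3) → Fin M₀ → (Fin M → Fin M₀) → ℝ} {β β' : (M₀ : ℕ) → (Fin M₀ → E3) → Fin M₀ → ℝ}
    (hβ : ∀ (M₀ : ℕ) (z₀ : Fin M₀ → E3) (c₀ : Fin M₀), 𝓘 M₀ z₀ c₀ → β M₀ z₀ c₀ ≤ β' M₀ z₀ c₀) (h : AdmBound 𝓘' τ δ T ℓ β) : AdmBound 𝓘 τ δ T ℓ β' :=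
  fun M z c M₀ z₀ c₀ e t hz hcl hm ht htT hch hf => (h M z c M₀ z₀ c₀ e t hz hcl hm ht htT (hch.mono_family hle) hf).trans (hβ M₀ z₀ c₀ hch.1)

/-- ★ **(F1-law) `FamilyEnvelopeLaw 𝓘 τ T Φ`** [ANALYTIC; decomposed at level 2] — (F1) `FamilyEnvelope` for charts of roughness AT MOST THE LAW, the modulus READ AT
THE LAW: `S(z₀) − Φ(z₀)(T z₀) ≤ S(z)`.  All that the seam to `EdgeFarFloor` consumes ((F2) charts at `t = T(z₀)`, (F3) certifies at `T(z₀)`). -/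
def FamilyEnvelopeLaw (𝓘 : (M₀ : ℕ) → (Fin M₀ → E3) → Fin M₀ → Prop) (τ : ℝ) (T : (M₀ : ℕ) → (Fin M₀ → E3) → Fin M₀ → ℝ)
    (Φ : (M₀ : ℕ) → (Fin M₀ → E3) → Fin M₀ → ℝ → ℝ) : Prop :=
  ∀ (M : ℕ) (z : Fin M → E3) (c : Fin M) (M₀ : ℕ) (z₀ : Fin M₀ → E3) (c₀ : Fin M₀) (e : Fin M → Fin M₀) (t : ℝ),
    Admissible M z c → CleanBall (63 / 10) z c → MonoPhaseBall (63 / 10) z c → 0 ≤ t → t ≤ T M₀ z₀ c₀ → ChartBy 𝓘 τ t z c z₀ c₀ e →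
      ballAvg (9 / 5) z₀ (xRec M₀ z₀) c₀ - Φ M₀ z₀ c₀ (T M₀ z₀ c₀) ≤ ballAvg (9 / 5) z (xRec M z) c

/-- ★★ THE LEVEL-2 SEAM OF ROUTE (D): (BAS-law `κA`) ∧ (T2 at `δ`) ∧ (MEM-law `κA`) ∧ (LIN-law at `δ`) ∧ (LAW `T ≤ tmax`) ∧ `κA·tmax ≤ δ` ⟹ (F1-law) with modulus
`Ψ + ϱ + μ` (for `ϱ = ϱ₀` literally the tree's `withColumns Ψ μ`).  Three inequalities added; the graded fine chart feeds (MEM-law) as is and (T2)/(LIN) through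
`κA·T(z₀) ≤ κA·tmax ≤ δ`. [folklore] -/
theorem familyEnvelopeLaw_of_taylor {𝓘 : (M₀ : ℕ) → (Fin M₀ → E3) → Fin M₀ → Prop} {τ κA δ tmax : ℝ} {T : (M₀ : ℕ) → (Fin M₀ → E3) → Fin M₀ → ℝ}
    {G : (M₁ : ℕ) → (Fin M₁ → E3) → Fin M₁ → Fin M₁ → (E3 →L[ℝ] ℝ)} {w : (M₁ : ℕ) → (Fin M₁ → E3) → Fin M₁ → Fin M₁ → Fin M₁ → ℝ}
    {ϱ μ : (M₁ : ℕ) → (Fin M₁ → E3) → Fin M₁ → ℝ} {Ψ : (M₁ : ℕ) → (Fin M₁ → E3) → Fin M₁ → ℝ → ℝ} (hκ : 0 ≤ κA) (hδ : κA * tmax ≤ δ)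
    (hT : LawLE 𝓘 T tmax) (hB : BasinLaw 𝓘 τ κA T) (hT2 : SmoothTaylorTwo 𝓘 τ δ G w ϱ) (hM : MembershipLaw 𝓘 τ κA T μ) (hL : SlavedLaw 𝓘 τ δ T G w Ψ) :
    FamilyEnvelopeLaw 𝓘 τ T (fun M₀ z₀ c₀ t => Ψ M₀ z₀ c₀ t + ϱ M₀ z₀ c₀ + μ M₀ z₀ c₀) := by
  intro M z c M₀ z₀ c₀ e t hz hcl hm ht htT hch
  have hf := hB M z c M₀ z₀ c₀ e t hz hcl hm ht htT hch
  have hfδ : FineChart δ z c z₀ c₀ e := fun a ha => (hf a ha).trans ((mul_le_mul_of_nonneg_left (hT M₀ z₀ c₀ hch.1) hκ).trans hδ)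
  have h₁ := hT2 M z c M₀ z₀ c₀ e t hz hch hfδ
  have h₂ := hM M z c M₀ z₀ c₀ e t hz hcl ht htT hch hf
  have h₃ := hL M z c M₀ z₀ c₀ e t hz hcl hm ht htT hch hfδ
  show _ - (Ψ M₀ z₀ c₀ (T M₀ z₀ c₀) + ϱ M₀ z₀ c₀ + μ M₀ z₀ c₀) ≤ _
  linarith

/-- ★★ THE LEVEL-0 SEAM OF ROUTE (D): (F1-law) ∧ (F2) ∧ (F3) ⟹ `EdgeFarFloor (63/10) (63/10) ρ ε η₂ φ` — the proof of the tree's `edgeFar_of_family` with the law cap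
discharged by `le_rfl` ((F2) charts at `t = T(z₀)`). [folklore] -/
theorem edgeFar_of_familyLaw {𝓘 : (M₀ : ℕ) → (Fin M₀ → E3) → Fin M₀ → Prop} {ρ ε η₂ τ φ : ℝ} {Φ : (M₀ : ℕ) → (Fin M₀ → E3) → Fin M₀ → ℝ → ℝ}
    {T : (M₀ : ℕ) → (Fin M₀ → E3) → Fin M₀ → ℝ} (hE : FamilyEnvelopeLaw 𝓘 τ T Φ) (hR : FamilyRoom 𝓘 ρ ε η₂ τ T) (hC : FamilyCert 𝓘 φ Φ T) :
    EdgeFarFloor (63 / 10) (63 / 10) ρ ε η₂ φ := by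
  intro M z c hz hcl hm hn hg
  obtain ⟨R, M₀, z₀, c₀, e, ht, hch⟩ := hR M z c hz hcl hm hn hg
  have h₁ := hE M (⇑R ∘ z) c M₀ z₀ c₀ e _ ((admissible_comp_iff R z c).2 hz) ((cleanBall_comp_iff R z c).2 hcl)
    ((monoPhaseBall_comp_iff R z c).2 hm) ht le_rfl hch
  rw [ballAvg_xRec_comp] at h₁
  have h₃ := hC M₀ z₀ c₀ hch.1
  linarith

/-- ★★ THE NODE OF ROUTE (D): (F1-law) ∧ (F2) ∧ (F3) ∧ [BRIDGE] ∧ [SOFT-FAR] ⟹ `CoreOffTubeFloor (63/10) (63/10) ρ ε φ`. [folklore] -/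
theorem coreOff_of_familyLaw_of_band_of_soft {𝓘 : (M₀ : ℕ) → (Fin M₀ → E3) → Fin M₀ → Prop} {ρ ε ηE η₂ τ φ : ℝ}
    {Φ : (M₀ : ℕ) → (Fin M₀ → E3) → Fin M₀ → ℝ → ℝ} {T : (M₀ : ℕ) → (Fin M₀ → E3) → Fin M₀ → ℝ} (hE : FamilyEnvelopeLaw 𝓘 τ T Φ)
    (hR : FamilyRoom 𝓘 ρ ε ηE τ T) (hC : FamilyCert 𝓘 φ Φ T) (hB : BandFarFloor (63 / 10) (63 / 10) ρ ε ηE η₂ φ)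
    (hS : SoftFarFloor (63 / 10) (63 / 10) ρ ε η₂ φ) : CoreOffTubeFloor (63 / 10) (63 / 10) ρ ε φ :=
  coreOff_of_edge_of_band_of_soft (edgeFar_of_familyLaw hE hR hC) hB hS

/-- THE TRADE, (F1): the g52 plain envelope (any roughness) ⟹ (F1-law) for every law (the chart is re-read at roughness `T(z₀)`). [formal bookkeeping] -/
theorem familyEnvelopeLaw_of_envelope {𝓘 : (M₀ : ℕ) → (Fin M₀ → E3) → Fin M₀ → Prop} {τ : ℝ} {Φ : (M₀ : ℕ) → (Fin M₀ → E3) → Fin M₀ → ℝ → ℝ}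
    (h : FamilyEnvelope 𝓘 τ Φ) (T : (M₀ : ℕ) → (Fin M₀ → E3) → Fin M₀ → ℝ) : FamilyEnvelopeLaw 𝓘 τ T Φ :=
  fun M z c M₀ z₀ c₀ e _ hz hcl hm ht htT hch => h M z c M₀ z₀ c₀ e (T M₀ z₀ c₀) hz hcl hm (ht.trans htT) (hch.mono_t htT)

/-- THE TRADE, (F1): the tree's `tmax`-capped plain envelope `FamilyEnvelopeOn anyChart 𝓘 τ 1 tmax Φ` ∧ (LAW) ⟹ (F1-law). [formal bookkeeping] -/
theorem familyEnvelopeLaw_of_on {𝓘 : (M₀ : ℕ) → (Fin M₀ → E3) → Fin M₀ → Prop} {τ tmax : ℝ} {Φ : (M₀ : ℕ) → (Fin M₀ → E3) → Fin M₀ → ℝ → ℝ}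
    {T : (M₀ : ℕ) → (Fin M₀ → E3) → Fin M₀ → ℝ} (hT : LawLE 𝓘 T tmax) (h : FamilyEnvelopeOn anyChart 𝓘 τ 1 tmax Φ) : FamilyEnvelopeLaw 𝓘 τ T Φ :=
  fun M z c M₀ z₀ c₀ e _ hz hcl hm ht htT hch =>
    h M z c M₀ z₀ c₀ e (T M₀ z₀ c₀) hz hcl hm (ht.trans htT) (hT M₀ z₀ c₀ hch.1) (by rw [one_mul]; exact hch.mono_t htT) trivial

/-- THE TRADE, (LIN): the tree's `tmax`-capped raw slaving `SlavedFirstOrder anyChart 𝓘 τ 1 tmax δ G w Ψ` ∧ (LAW) ⟹ (LIN-law). [formal bookkeeping] -/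
theorem slavedLaw_of_slavedFirstOrder {𝓘 : (M₀ : ℕ) → (Fin M₀ → E3) → Fin M₀ → Prop} {τ δ tmax : ℝ} {T : (M₀ : ℕ) → (Fin M₀ → E3) → Fin M₀ → ℝ}
    {G : (M₁ : ℕ) → (Fin M₁ → E3) → Fin M₁ → Fin M₁ → (E3 →L[ℝ] ℝ)} {w : (M₁ : ℕ) → (Fin M₁ → E3) → Fin M₁ → Fin M₁ → Fin M₁ → ℝ}
    {Ψ : (M₁ : ℕ) → (Fin M₁ → E3) → Fin M₁ → ℝ → ℝ} (hT : LawLE 𝓘 T tmax) (h : SlavedFirstOrder anyChart 𝓘 τ 1 tmax δ G w Ψ) :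
    SlavedLaw 𝓘 τ δ T G w Ψ :=
  fun M z c M₀ z₀ c₀ e _ hz hcl hm ht htT hch hf =>
    h M z c M₀ z₀ c₀ e (T M₀ z₀ c₀) hz hcl hm (ht.trans htT) (hT M₀ z₀ c₀ hch.1) (by rw [one_mul]; exact hch.mono_t htT) trivial hf

/-- (BAS-law) gives the tree's FIXED-radius fine chart `δ` below the law when `κA·tmax ≤ δ`. [formal bookkeeping] -/
theorem fineChart_of_basinLaw {𝓘 : (M₀ : ℕ) → (Fin M₀ → E3) → Fin M₀ → Prop} {τ κA δ tmax : ℝ} {T : (M₀ : ℕ) → (Fin M₀ → E3) → Fin M₀ → ℝ} (hκ : 0 ≤ κA)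
    (hδ : κA * tmax ≤ δ) (hT : LawLE 𝓘 T tmax) (h : BasinLaw 𝓘 τ κA T) {M : ℕ} {z : Fin M → E3} {c : Fin M} {M₀ : ℕ} {z₀ : Fin M₀ → E3} {c₀ : Fin M₀}
    {e : Fin M → Fin M₀} {t : ℝ} (hz : Admissible M z c) (hcl : CleanBall (63 / 10) z c) (hm : MonoPhaseBall (63 / 10) z c) (ht : 0 ≤ t)
    (htT : t ≤ T M₀ z₀ c₀) (hch : ChartBy 𝓘 τ t z c z₀ c₀ e) : FineChart δ z c z₀ c₀ e :=
  fun a ha => (h M z c M₀ z₀ c₀ e t hz hcl hm ht htT hch a ha).trans ((mul_le_mul_of_nonneg_left (hT M₀ z₀ c₀ hch.1) hκ).trans hδ)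

/-- (BAS-law) is ANTITONE in the family and in `κA`. [formal bookkeeping] -/
theorem basinLaw_anti {𝓘 𝓘' : (M₀ : ℕ) → (Fin M₀ → E3) → Fin M₀ → Prop} (hle : FamilyLE 𝓘 𝓘') {τ κA κA' : ℝ} (hκ : κA' ≤ κA)
    {T : (M₀ : ℕ) → (Fin M₀ → E3) → Fin M₀ → ℝ} (h : BasinLaw 𝓘' τ κA' T) : BasinLaw 𝓘 τ κA T :=
  fun M z c M₀ z₀ c₀ e t hz hcl hm ht htT hch a ha =>
    (h M z c M₀ z₀ c₀ e t hz hcl hm ht htT (hch.mono_family hle) a ha).trans (mul_le_mul_of_nonneg_right hκ (ht.trans htT))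

/-- (LIN-law) is ANTITONE in the family. [formal bookkeeping] -/
theorem slavedLaw_anti {𝓘 𝓘' : (M₀ : ℕ) → (Fin M₀ → E3) → Fin M₀ → Prop} (hle : FamilyLE 𝓘 𝓘') {τ δ : ℝ} {T : (M₀ : ℕ) → (Fin M₀ → E3) → Fin M₀ → ℝ}
    {G : (M₁ : ℕ) → (Fin M₁ → E3) → Fin M₁ → Fin M₁ → (E3 →L[ℝ] ℝ)} {w : (M₁ : ℕ) → (Fin M₁ → E3) → Fin M₁ → Fin M₁ → Fin M₁ → ℝ}
    {Ψ : (M₁ : ℕ) → (Fin M₁ → E3) → Fin M₁ → ℝ → ℝ} (h : SlavedLaw 𝓘' τ δ T G w Ψ) : SlavedLaw 𝓘 τ δ T G w Ψ :=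
  fun M z c M₀ z₀ c₀ e t hz hcl hm ht htT hch hf => h M z c M₀ z₀ c₀ e t hz hcl hm ht htT (hch.mono_family hle) hf

/-- (F3) is ANTITONE in the modulus at the law (a DIAGONAL domination `Φ'(z₀)(T z₀) ≤ Φ(z₀)(T z₀)` transfers the certificate). [formal bookkeeping] -/
theorem familyCert_of_dom {𝓘 : (M₀ : ℕ) → (Fin M₀ → E3) → Fin M₀ → Prop} {φ : ℝ} {Φ Φ' : (M₀ : ℕ) → (Fin M₀ → E3) → Fin M₀ → ℝ → ℝ}
    {T : (M₀ : ℕ) → (Fin M₀ → E3) → Fin M₀ → ℝ} (hC : FamilyCert 𝓘 φ Φ T)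
    (hD : ∀ (M₀ : ℕ) (z₀ : Fin M₀ → E3) (c₀ : Fin M₀), 𝓘 M₀ z₀ c₀ → Φ' M₀ z₀ c₀ (T M₀ z₀ c₀) ≤ Φ M₀ z₀ c₀ (T M₀ z₀ c₀)) : FamilyCert 𝓘 φ Φ' T :=
  fun M₀ z₀ c₀ hI => by have := hC M₀ z₀ c₀ hI; have := hD M₀ z₀ c₀ hI; linarith

/-! ## §3. The pins and THE DIRECT RECORD `coreOff_record_g55d` -/

/-- ★ Pin: the basin amplification of route (D) `κA₁ := 5/2` (`κA₁·tmax₀ = 1/24 ≤ δ₀ = 1/20`; KAPPA28 rays `≤ 1.99`, ×1.25 margin pending BASIN29). -/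
def kA1 : ℝ := 5 / 2

/-- `0 ≤ κA₁`. [formal bookkeeping] -/
theorem kA1_nonneg : (0 : ℝ) ≤ kA1 := by rw [kA1]; norm_num

/-- `κA₁·tmax₀ ≤ δ₀`. [formal bookkeeping] -/
theorem kA1_mul_tmax0_le : kA1 * tmax0 ≤ delta0 := by rw [kA1, tmax0, delta0]; norm_num

/-- The reach of route (D) stays `≤ 1/10` on `𝓘₀`: `κA₁·T₀(z₀) ≤ κA₁·tmax₀ = 1/24`. [formal bookkeeping] -/
theorem kA1_mul_T0_le {M₀ : ℕ} {z₀ : Fin M₀ → E3} {c₀ : Fin M₀} (hI : ChartFamilyD M₀ z₀ c₀) : kA1 * T0 M₀ z₀ c₀ ≤ 1 / 10 := by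
  have h := mul_le_mul_of_nonneg_left (lawLE_chartFamilyD M₀ z₀ c₀ hI) kA1_nonneg
  rw [kA1, tmax0] at h; rw [kA1]; linarith

/-- ★ **(BASᴰ)** `:= BasinLaw 𝓘₀ (1/4) κA₁ T₀`. -/
def BasinD : Prop := BasinLaw ChartFamilyD tau0 kA1 T0

/-- ★ **(MEMᴰ μ)** `:= MembershipLaw 𝓘₀ (1/4) κA₁ T₀ μ` (column of record: `clearedColumn κA₁ T₀ μ_adv`, MG). -/
def MembershipD (μ : (M₁ : ℕ) → (Fin M₁ → E3) → Fin M₁ → ℝ) : Prop := MembershipLaw ChartFamilyD tau0 kA1 T0 μ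

/-- ★ **(LINᴰ Ψ)** `:= SlavedLaw 𝓘₀ (1/4) δ₀ T₀ G₀ w₀ Ψ` — the RAW first-order LP column. -/
def SlavedD (Ψ : (M₁ : ℕ) → (Fin M₁ → E3) → Fin M₁ → ℝ → ℝ) : Prop := SlavedLaw ChartFamilyD tau0 delta0 T0 G0 w0 Ψ

/-- ★ **(F1ᴰ Φ)** `:= FamilyEnvelopeLaw 𝓘₀ (1/4) T₀ Φ`. -/
def EnvelopeD (Φ : (M₁ : ℕ) → (Fin M₁ → E3) → Fin M₁ → ℝ → ℝ) : Prop := FamilyEnvelopeLaw ChartFamilyD tau0 T0 Φ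

/-- ★ **(F3ᴰ Φ)** `:= FamilyCert 𝓘₀ 0 Φ T₀` — the DIAGONAL table certificate `0 ≤ S(z₀) − Φ(z₀)(T₀ z₀)`. -/
def FamilyCertD (Φ : (M₁ : ℕ) → (Fin M₁ → E3) → Fin M₁ → ℝ → ℝ) : Prop := FamilyCert ChartFamilyD 0 Φ T0

/-- (MEMᴰ) with the ZERO column HOLDS on any subfamily of `𝓘₀` all of whose instances clear `κA₁·T₀(z₀)` (MG `membershipLaw_zero_of_clear`; census CLEAR decides
the instances — expected ✓ HZ00 / FZ00 / HE52, ✗ HM62). [formal bookkeeping] -/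
theorem membershipLaw_zero_of_clear_D {𝓘 : (M₀ : ℕ) → (Fin M₀ → E3) → Fin M₀ → Prop} (hle : FamilyLE 𝓘 ChartFamilyD)
    (hclear : ∀ (M₁ : ℕ) (z₁ : Fin M₁ → E3) (c₁ : Fin M₁), 𝓘 M₁ z₁ c₁ → CollarClear (kA1 * T0 M₁ z₁ c₁) z₁ c₁) :
    MembershipLaw 𝓘 tau0 kA1 T0 (fun _ _ _ => 0) :=
  membershipLaw_zero_of_clear (by rw [tau0]; norm_num) (fun M₁ z₁ c₁ hI => kA1_mul_T0_le (hle M₁ z₁ c₁ hI)) hclear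

/-- ★★ (BASᴰ) ∧ (T2ᴰ) ∧ (MEMᴰ μ) ∧ (LINᴰ Ψ) ⟹ (F1ᴰ (Ψ + ϱ₀ + μ)) — the modulus is the tree's `withColumns Ψ μ`. [folklore] -/
theorem envelopeD_of_taylor {Ψ : (M₁ : ℕ) → (Fin M₁ → E3) → Fin M₁ → ℝ → ℝ} {μ : (M₁ : ℕ) → (Fin M₁ → E3) → Fin M₁ → ℝ} (hB : BasinD) (hT : TaylorTwoD)
    (hM : MembershipD μ) (hL : SlavedD Ψ) : EnvelopeD (withColumns Ψ μ) :=
  familyEnvelopeLaw_of_taylor kA1_nonneg kA1_mul_tmax0_le lawLE_chartFamilyD hB hT hM hL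

/-- ★★ (F1ᴰ Φ) ∧ (F2-bent₀) ∧ (F3ᴰ Φ) ⟹ `EdgeFarFloor (63/10) (63/10) (24/5) (1/100) (3/50) 0`. [folklore] -/
theorem edgeFar_D {Φ : (M₁ : ℕ) → (Fin M₁ → E3) → Fin M₁ → ℝ → ℝ} (hE : EnvelopeD Φ) (hR : FamilyRoomBent0) (hC : FamilyCertD Φ) :
    EdgeFarFloor (63 / 10) (63 / 10) (24 / 5) (1 / 100) (3 / 50) 0 := by
  have h := edgeFar_of_familyLaw hE hR hC
  rwa [etaE] at h

/-- ★★★★ **THE DIRECT RECORD `coreOff_record_g55d`** — [CORE-FAR] `CoreOffTubeFloor (63/10) (63/10) (24/5) (1/100) 0` from SEVEN hypotheses: (BASᴰ) · (MEMᴰ μ) ·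
(LINᴰ Ψ) · (F2-bent₀) = the tree's `FamilyRoomBent0` · (F3ᴰ (Ψ+ϱ₀+μ)) · [BRIDGE] · [SOFT-FAR]; (T2ᴰ) is the theorem `taylorTwoD_holds`.  No recut, no pairs,
no kinematics, no domination, no level transport. [folklore] -/
theorem coreOff_record_g55d {Ψ : (M₁ : ℕ) → (Fin M₁ → E3) → Fin M₁ → ℝ → ℝ} {μ : (M₁ : ℕ) → (Fin M₁ → E3) → Fin M₁ → ℝ} (hB : BasinD) (hM : MembershipD μ)
    (hL : SlavedD Ψ) (hR : FamilyRoomBent0) (hC : FamilyCertD (withColumns Ψ μ)) (hBand : BandFarFloor (63 / 10) (63 / 10) (24 / 5) (1 / 100) (3 / 50) (1 / 10) 0)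
    (hS : SoftFarFloor (63 / 10) (63 / 10) (24 / 5) (1 / 100) (1 / 10) 0) : CoreOffTubeFloor (63 / 10) (63 / 10) (24 / 5) (1 / 100) 0 :=
  coreOff_of_edge_of_band_of_soft (edgeFar_D (envelopeD_of_taylor hB taylorTwoD_holds hM hL) hR hC) hBand hS

/-- ★★★ THE DIRECT RECORD, EDGE BAND: the five binders ⟹ `EdgeFarFloor (63/10) (63/10) (24/5) (1/100) (3/50) 0`. [folklore] -/
theorem edgeFar_record_g55d {Ψ : (M₁ : ℕ) → (Fin M₁ → E3) → Fin M₁ → ℝ → ℝ} {μ : (M₁ : ℕ) → (Fin M₁ → E3) → Fin M₁ → ℝ} (hB : BasinD) (hM : MembershipD μ)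
    (hL : SlavedD Ψ) (hR : FamilyRoomBent0) (hC : FamilyCertD (withColumns Ψ μ)) : EdgeFarFloor (63 / 10) (63 / 10) (24 / 5) (1 / 100) (3 / 50) 0 :=
  edgeFar_D (envelopeD_of_taylor hB taylorTwoD_holds hM hL) hR hC

/-- ★★ THE DIRECT RECORD WITH THE CLEARED COLUMN: given (MEMᴰ μ), the table certificate may use `clearedColumn κA₁ T₀ μ` — ZERO on every instance whose collars
clear `κA₁·T₀(z₀)` (MG `membershipLaw_cleared`; the reach is `≤ 1/24` on `𝓘₀`). [folklore] -/
theorem coreOff_record_g55d_cleared {Ψ : (M₁ : ℕ) → (Fin M₁ → E3) → Fin M₁ → ℝ → ℝ} {μ : (M₁ : ℕ) → (Fin M₁ → E3) → Fin M₁ → ℝ} (hB : BasinD)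
    (hM : MembershipD μ) (hL : SlavedD Ψ) (hR : FamilyRoomBent0) (hC : FamilyCertD (withColumns Ψ (clearedColumn kA1 T0 μ)))
    (hBand : BandFarFloor (63 / 10) (63 / 10) (24 / 5) (1 / 100) (3 / 50) (1 / 10) 0) (hS : SoftFarFloor (63 / 10) (63 / 10) (24 / 5) (1 / 100) (1 / 10) 0) :
    CoreOffTubeFloor (63 / 10) (63 / 10) (24 / 5) (1 / 100) 0 :=
  coreOff_record_g55d hB (membershipLaw_cleared (by rw [tau0]; norm_num) (fun _ _ _ hI => kA1_mul_T0_le hI) hM) hL hR hC hBand hS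

/-- ★★ THE DIRECT RECORD MODULO THE SECOND-ORDER COLUMN: with ANY certified (T2) column `ϱ` on `𝓘₀` (e.g. the sharper T2⁻ of the KBAND⁻ partition, once typed) in
place of the proved `ϱ₀`: (BASᴰ) · (T2 at `ϱ`) · (MEMᴰ μ) · (LINᴰ Ψ) · (F2-bent₀) · (F3ᴰ (Ψ + ϱ + μ)) · [BRIDGE] · [SOFT-FAR] ⟹ [CORE-FAR]. [folklore] -/
theorem coreOff_record_g55d_rho {Ψ : (M₁ : ℕ) → (Fin M₁ → E3) → Fin M₁ → ℝ → ℝ} {ϱ μ : (M₁ : ℕ) → (Fin M₁ → E3) → Fin M₁ → ℝ} (hB : BasinD)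
    (hT2 : SmoothTaylorTwo ChartFamilyD tau0 delta0 G0 w0 ϱ) (hM : MembershipD μ) (hL : SlavedD Ψ) (hR : FamilyRoomBent0)
    (hC : FamilyCertD fun M₁ z₁ c₁ t => Ψ M₁ z₁ c₁ t + ϱ M₁ z₁ c₁ + μ M₁ z₁ c₁) (hBand : BandFarFloor (63 / 10) (63 / 10) (24 / 5) (1 / 100) (3 / 50) (1 / 10) 0)
    (hS : SoftFarFloor (63 / 10) (63 / 10) (24 / 5) (1 / 100) (1 / 10) 0) : CoreOffTubeFloor (63 / 10) (63 / 10) (24 / 5) (1 / 100) 0 :=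
  coreOff_of_edge_of_band_of_soft (edgeFar_D (familyEnvelopeLaw_of_taylor kA1_nonneg kA1_mul_tmax0_le lawLE_chartFamilyD hB hT2 hM hL) hR hC) hBand hS

/-! ## §4. The same (MEM-law) for the recut fallback (LU / Φ₂): paired binders at the law and their seam -/

/-- **(BASᴿ-law) `PairedBasinL P 𝓘₀ 𝓘₁ 𝓑₀ τ₀ τ₁ κL T κA`** [ANALYTIC · INSTRUMENTABLE] — the tree's (BASᴿ) `PairedBasin` with the fixed radius `δ` replaced by the
chart instance's graded radius `κA·T(z₀)` AT THE LAW. -/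
def PairedBasinL (P : (M : ℕ) → (Fin M → E3) → Fin M → (M₁ : ℕ) → (Fin M₁ → E3) → Fin M₁ → (Fin M → Fin M₁) → ℝ → Prop)
    (𝓘₀ 𝓘₁ : (M₀ : ℕ) → (Fin M₀ → E3) → Fin M₀ → Prop) (𝓑₀ : Set (E3 → E3)) (τ₀ τ₁ κL : ℝ) (T : (M₀ : ℕ) → (Fin M₀ → E3) → Fin M₀ → ℝ) (κA : ℝ) :
    Prop :=
  ∀ (M : ℕ) (z : Fin M → E3) (c : Fin M) (M₀ : ℕ) (z₀ : Fin M₀ → E3) (c₀ : Fin M₀) (e₀ : Fin M → Fin M₀) (M₁ : ℕ) (z₁ : Fin M₁ → E3) (c₁ : Fin M₁)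
    (e₁ : Fin M → Fin M₁) (t : ℝ), Admissible M z c → CleanBall (63 / 10) z c → MonoPhaseBall (63 / 10) z c → 0 ≤ t → t ≤ T M₀ z₀ c₀ →
      PairedChart 𝓘₀ 𝓘₁ 𝓑₀ τ₀ τ₁ κL t z c z₀ c₀ e₀ z₁ c₁ e₁ → P M z c M₁ z₁ c₁ e₁ t → FineChart (κA * T M₀ z₀ c₀) z c z₁ c₁ e₁

/-- **(MEMᴿ-law) `PairedMembershipL 𝓘₀ 𝓘₁ 𝓑₀ τ₀ τ₁ κL T κA μ`** [COMBINATORIAL + TABLE] — the tree's (MEMᴿ) with the fine radius `κA·T(z₀)` of the chart instance. -/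
def PairedMembershipL (𝓘₀ 𝓘₁ : (M₀ : ℕ) → (Fin M₀ → E3) → Fin M₀ → Prop) (𝓑₀ : Set (E3 → E3)) (τ₀ τ₁ κL : ℝ) (T : (M₀ : ℕ) → (Fin M₀ → E3) → Fin M₀ → ℝ)
    (κA : ℝ) (μ : (M₁ : ℕ) → (Fin M₁ → E3) → Fin M₁ → ℝ) : Prop :=
  ∀ (M : ℕ) (z : Fin M → E3) (c : Fin M) (M₀ : ℕ) (z₀ : Fin M₀ → E3) (c₀ : Fin M₀) (e₀ : Fin M → Fin M₀) (M₁ : ℕ) (z₁ : Fin M₁ → E3) (c₁ : Fin M₁)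
    (e₁ : Fin M → Fin M₁) (t : ℝ), Admissible M z c → CleanBall (63 / 10) z c → 0 ≤ t → t ≤ T M₀ z₀ c₀ →
      PairedChart 𝓘₀ 𝓘₁ 𝓑₀ τ₀ τ₁ κL t z c z₀ c₀ e₀ z₁ c₁ e₁ → FineChart (κA * T M₀ z₀ c₀) z c z₁ c₁ e₁ →
        frozenAvg z c z₁ c₁ e₁ - μ M₁ z₁ c₁ ≤ ballAvg (9 / 5) z (xRec M z) c

/-- THE TRADE: the tree's unpaired uniform-radius (MEM) on the comparison family ⟹ (MEMᴿ-law) whenever `κA·T(z₀) ≤ δ` on `𝓘₀`. [formal bookkeeping] -/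
theorem pairedMembershipL_of_column {𝓘₀ 𝓘₁ : (M₀ : ℕ) → (Fin M₀ → E3) → Fin M₀ → Prop} {𝓑₀ : Set (E3 → E3)} {τ₀ τ₁ κL κA δ : ℝ}
    {T : (M₀ : ℕ) → (Fin M₀ → E3) → Fin M₀ → ℝ} (hδ : ∀ (M₀ : ℕ) (z₀ : Fin M₀ → E3) (c₀ : Fin M₀), 𝓘₀ M₀ z₀ c₀ → κA * T M₀ z₀ c₀ ≤ δ)
    {μ : (M₁ : ℕ) → (Fin M₁ → E3) → Fin M₁ → ℝ} (h : MembershipColumn 𝓘₁ τ₁ δ μ) : PairedMembershipL 𝓘₀ 𝓘₁ 𝓑₀ τ₀ τ₁ κL T κA μ :=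
  fun M z c M₀ z₀ c₀ _ M₁ z₁ c₁ e₁ _ hz hcl _ _ hpc hf => h M z c M₁ z₁ c₁ e₁ τ₁ hz hcl hpc.2.2 (fun a ha => (hf a ha).trans (hδ M₀ z₀ c₀ hpc.1.1))

/-- ★ THE CLEARED TRADE, paired: (MEMᴿ-law `μ`) ⟹ (MEMᴿ-law) with `μ` switched OFF on comparison instances whose collars clear a UNIFORM radius `r` with
`κA·T ≤ r` on `𝓘₀` and `τ₁ + r ≤ 27/10` (e.g. `r = κA·tmax`). [folklore] -/
theorem pairedMembershipL_cleared {𝓘₀ 𝓘₁ : (M₀ : ℕ) → (Fin M₀ → E3) → Fin M₀ → Prop} {𝓑₀ : Set (E3 → E3)} {τ₀ τ₁ κL κA r : ℝ}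
    {T : (M₀ : ℕ) → (Fin M₀ → E3) → Fin M₀ → ℝ} (hτr : τ₁ + r ≤ 27 / 10) (hr : ∀ (M₀ : ℕ) (z₀ : Fin M₀ → E3) (c₀ : Fin M₀), 𝓘₀ M₀ z₀ c₀ → κA * T M₀ z₀ c₀ ≤ r)
    {μ : (M₁ : ℕ) → (Fin M₁ → E3) → Fin M₁ → ℝ} (h : PairedMembershipL 𝓘₀ 𝓘₁ 𝓑₀ τ₀ τ₁ κL T κA μ) :
    PairedMembershipL 𝓘₀ 𝓘₁ 𝓑₀ τ₀ τ₁ κL T κA (fun M₁ z₁ c₁ => if CollarClear r z₁ c₁ then 0 else μ M₁ z₁ c₁) := by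
  intro M z c M₀ z₀ c₀ e₀ M₁ z₁ c₁ e₁ t hz hcl ht htT hpc hf
  show _ - (if CollarClear r z₁ c₁ then (0 : ℝ) else μ M₁ z₁ c₁) ≤ _
  by_cases hclear : CollarClear r z₁ c₁
  · have hle := hr M₀ z₀ c₀ hpc.1.1
    rw [if_pos hclear, sub_zero, frozenAvg_eq_ballAvg_of_chartBy (by linarith) hpc.2.2 hf (hclear.anti hle) hcl]
  · rw [if_neg hclear]; exact h M z c M₀ z₀ c₀ e₀ M₁ z₁ c₁ e₁ t hz hcl ht htT hpc hf

/-- (BASᴿ-law) gives the tree's fixed-radius (BASᴿ) when `κA·tmax ≤ δ` and the law is `≤ tmax` on `𝓘₀`. [formal bookkeeping] -/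
theorem pairedBasin_of_L {P : (M : ℕ) → (Fin M → E3) → Fin M → (M₁ : ℕ) → (Fin M₁ → E3) → Fin M₁ → (Fin M → Fin M₁) → ℝ → Prop}
    {𝓘₀ 𝓘₁ : (M₀ : ℕ) → (Fin M₀ → E3) → Fin M₀ → Prop} {𝓑₀ : Set (E3 → E3)} {τ₀ τ₁ κL κA δ tmax : ℝ} {T : (M₀ : ℕ) → (Fin M₀ → E3) → Fin M₀ → ℝ}
    (hκ : 0 ≤ κA) (hδ : κA * tmax ≤ δ) (hT : LawLE 𝓘₀ T tmax) (h : PairedBasinL P 𝓘₀ 𝓘₁ 𝓑₀ τ₀ τ₁ κL T κA) : PairedBasin P 𝓘₀ 𝓘₁ 𝓑₀ τ₀ τ₁ κL T δ :=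
  fun M z c M₀ z₀ c₀ e₀ M₁ z₁ c₁ e₁ t hz hcl hm ht htT hpc hP a ha =>
    (h M z c M₀ z₀ c₀ e₀ M₁ z₁ c₁ e₁ t hz hcl hm ht htT hpc hP a ha).trans ((mul_le_mul_of_nonneg_left (hT M₀ z₀ c₀ hpc.1.1) hκ).trans hδ)

/-- ★★ THE PAIRED SEAM AT THE LAW: (BASᴿ-law `κA`) ∧ (T2 on `𝓘₁` at `δ`) ∧ (MEMᴿ-law `κA`) ∧ (LINᴿ at `δ`) ∧ (LAW on `𝓘₀`) ∧ `κA·tmax ≤ δ` ⟹ (ENVᴿ_P) with modulus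
`Ψ(t) + ϱ + μ` — the tree's `pairedEnvelopeOn_of_taylor` with the membership radius graded by the law. [folklore] -/
theorem pairedEnvelopeOn_of_taylorL {P : (M : ℕ) → (Fin M → E3) → Fin M → (M₁ : ℕ) → (Fin M₁ → E3) → Fin M₁ → (Fin M → Fin M₁) → ℝ → Prop}
    {𝓘₀ 𝓘₁ : (M₀ : ℕ) → (Fin M₀ → E3) → Fin M₀ → Prop} {𝓑₀ : Set (E3 → E3)} {τ₀ τ₁ κL κA δ tmax : ℝ} {T : (M₀ : ℕ) → (Fin M₀ → E3) → Fin M₀ → ℝ}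
    {G : (M₁ : ℕ) → (Fin M₁ → E3) → Fin M₁ → Fin M₁ → (E3 →L[ℝ] ℝ)} {w : (M₁ : ℕ) → (Fin M₁ → E3) → Fin M₁ → Fin M₁ → Fin M₁ → ℝ}
    {ϱ μ : (M₁ : ℕ) → (Fin M₁ → E3) → Fin M₁ → ℝ} {Ψ : (M₁ : ℕ) → (Fin M₁ → E3) → Fin M₁ → ℝ → ℝ} (hκ : 0 ≤ κA) (hδ : κA * tmax ≤ δ) (hT : LawLE 𝓘₀ T tmax)
    (hB : PairedBasinL P 𝓘₀ 𝓘₁ 𝓑₀ τ₀ τ₁ κL T κA) (hT2 : SmoothTaylorTwo 𝓘₁ τ₁ δ G w ϱ) (hM : PairedMembershipL 𝓘₀ 𝓘₁ 𝓑₀ τ₀ τ₁ κL T κA μ)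
    (hL : PairedSlaved P 𝓘₀ 𝓘₁ 𝓑₀ τ₀ τ₁ κL T δ G w Ψ) :
    PairedEnvelopeOn P 𝓘₀ 𝓘₁ 𝓑₀ τ₀ τ₁ κL T (fun M₁ z₁ c₁ t => Ψ M₁ z₁ c₁ t + ϱ M₁ z₁ c₁ + μ M₁ z₁ c₁) := by
  intro M z c M₀ z₀ c₀ e₀ M₁ z₁ c₁ e₁ t hz hcl hm ht htT hpc hP
  have hf := hB M z c M₀ z₀ c₀ e₀ M₁ z₁ c₁ e₁ t hz hcl hm ht htT hpc hP
  have hfδ : FineChart δ z c z₁ c₁ e₁ := pairedBasin_of_L hκ hδ hT hB M z c M₀ z₀ c₀ e₀ M₁ z₁ c₁ e₁ t hz hcl hm ht htT hpc hP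
  have h₁ := hT2 M z c M₁ z₁ c₁ e₁ τ₁ hz hpc.2.2 hfδ
  have h₂ := hM M z c M₀ z₀ c₀ e₀ M₁ z₁ c₁ e₁ t hz hcl ht htT hpc hf
  have h₃ := hL M z c M₀ z₀ c₀ e₀ M₁ z₁ c₁ e₁ t hz hcl hm ht htT hpc hP hfδ
  show _ - (Ψ M₁ z₁ c₁ t + ϱ M₁ z₁ c₁ + μ M₁ z₁ c₁) ≤ _
  linarith

end Summit.AtomisticToContinuum.Crystallization.Theorems.FrustratedLawDichotomyStrainedPatchDirect
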